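import Literature.Geometry.Lorentzian.IPlusRegular
import Literature.Geometry.Lorentzian.StationaryBlackHoleUniquenessProofs
import Literature.Geometry.Lorentzian.StaticBlackHoleUniquenessProofs
import Literature.Geometry.Lorentzian.StationaryOrbitTrivialization
import Literature.Geometry.Lorentzian.CauchyDevelopmentRestrict
import Literature.Geometry.Lorentzian.EinsteinTensorNaturality
import Literature.Geometry.Lorentzian.OpensCausality
import Literature.Geometry.Manifold.OpenSubmanifoldTangent
import HarnessLib

/-!
# The domain of outer communications as a stationary space-time in its own right
(Chruściel–Costa 2008, §2.2 and Def. 1.1; Anderson 2000, §0, (0.1), applied to `⟨⟨M_ext⟩⟩`)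

Let `𝓑` be a stationary asymptotically flat black-hole space-time (`StationaryAFBlackHole`:
complete Killing field `T = 𝓑.killing`, future timelike on `M_ext`) and
`⟨⟨M_ext⟩⟩ = I⁺(M_ext) ∩ I⁻(M_ext) = 𝓑.doc` its domain of outer communications, an open
(`𝓑.docOpens hF hP`), connected (`isConnected_doc`), flow-invariant
(`mem_doc_of_isMIntegralCurve`) subset. The uniqueness theory of stationary black holes works on
the space-time `(⟨⟨M_ext⟩⟩, g|, τ|)` — Chruściel–Costa, Astérisque 321 (2008) = arXiv:0806.0016,
Def. 1.1 ("if `⟨⟨M_ext⟩⟩` is globally hyperbolic"), §4.2 (the structure theorem: "the flow of `K₀`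
… is by time translations"), §7.2 and Thm. 1.4 (the static case: "`⟨⟨M_ext⟩⟩` is static … the
orbit space"); Chruściel–Costa–Heusler, Living Rev. Relativity 15 (2012) 7, §3.1 — and this file
builds that object over the prelude and proves what the orbit-space construction of
`StationaryOrbitSpaceManifold.lean` ff. (Anderson, Ann. Henri Poincaré 1 (2000), §0) asks of it:

* `StationaryAFBlackHole.docMetric`, `….docTimeOrientation`, `….docSpacetime 𝓑 hF hP` — the
  restricted metric `g|` and time orientation `τ|` on the open submanifold `↥(𝓑.docOpens hF hP)`
  and the open sub-space-time `(⟨⟨M_ext⟩⟩, g|, τ|)` they form (the content of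
  `Spacetime.restrict`, `docSpacetime_eq_restrict`; all three reducible, so that carrier, metric
  and time orientation of `docSpacetime` are the displayed ones definitionally), with
  `docKilling = T|⟨⟨M_ext⟩⟩`;
* `isKillingField_docKilling` — **`T|⟨⟨M_ext⟩⟩` is a Killing field of `g|⟨⟨M_ext⟩⟩`** (the
  restricted metric is the pullback along the inclusion, `restrict_eq_comap`; Killing fields pull
  back, `IsKillingField.comap_mpullback`; O'Neill 1983, Ch. 9, Prop. 9.25), and
  `leviCivita_docKilling_apply` — `∇^{g|}(T|) = (∇^g T)|` (O'Neill 1983, Ch. 3, Prop. 3.59);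
* `isCompleteVectorField_docKilling` — **`T|⟨⟨M_ext⟩⟩` is complete** (orbits of `T` through
  `⟨⟨M_ext⟩⟩` stay in `⟨⟨M_ext⟩⟩`, Chruściel–Costa 2008, §2.2; integral curves of an open
  sub-manifold are the ambient integral curves lying in it, `isMIntegralCurve_subtypeVal_comp_iff`);
* `IsIPlusRegular.isChronological_docSpacetime` — **an `I⁺`-regular d.o.c. is chronological**
  (strong causality holds at its points, Chruściel–Costa 2008, Def. 1.1 with Hawking–Ellis 1973,
  §6.6; a closed timelike curve of the sub-space-time is one of `M`,
  `isFutureTimelikeCurveOn_restrict_iff`);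
* `isFutureDirected_killing_of_forall_isTimelike` — if `T` is timelike on `⟨⟨M_ext⟩⟩` it is
  **future-directed** there (`g(τ, T)` is continuous, non-zero on the connected `⟨⟨M_ext⟩⟩`,
  negative on `M_ext`), whence `isStationaryKilling_docKilling` — **`(⟨⟨M_ext⟩⟩, g|, τ|, T|)` is a
  stationary space-time with everywhere timelike Killing field** in the sense of `Stationary.lean`
  (`IsStationaryKilling … univ`), the standing hypothesis of the orbit-space files;
* consequences for an `I⁺`-regular black hole with `T` timelike on `⟨⟨M_ext⟩⟩` (the static case
  after the Vishveshwara–Carter lemma and Chruściel–Galloway 2010, Thm. 1.1; cf.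
  `IsIPlusRegular.isTimelike_killing_or_exists_prehorizonPoint`, `DocStaticUniquenessProofs.lean`):
  `IsIPlusRegular.exists_docTimeFunction` — a `C^∞` time function `t` on `⟨⟨M_ext⟩⟩` with
  `t ∘ φₛ = t + s`; `IsIPlusRegular.isManifold_docOrbitSpace` — the orbit space `⟨⟨M_ext⟩⟩/ℝ` is a
  smooth Hausdorff second-countable connected `3`-manifold; `IsIPlusRegular.exists_docTrivialization`
  — `⟨⟨M_ext⟩⟩ ≅ ℝ × (⟨⟨M_ext⟩⟩/ℝ)` with the stationary flow acting by translations (Anderson 2000,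
  (0.1); Chruściel–Costa 2008, §4.2, (4.15): "`⟨⟨M_ext⟩⟩ ∩ M` is diffeomorphic to `ℝ × S`, with
  the flow of `K₀` consisting of translations along the `ℝ` axis", here for the static/strictly
  stationary d.o.c. where no blow-up `M` of the axis is needed);
* transport of the remaining hypotheses of the static classification to the sub-space-time:
  `isRicciFlat_docMetric` (vacuum restricts, `ricci_comap_apply`),
  `twistForm_docKilling_eq` and `isHypersurfaceOrthogonalOn_docKilling_univ_iff` — **`T` is
  hypersurface-orthogonal on `⟨⟨M_ext⟩⟩` iff `T|⟨⟨M_ext⟩⟩` is hypersurface-orthogonal on the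
  whole sub-space-time** (the d.o.c.-static hypothesis of
  `ChruscielGalloway2010_docStaticUniqueness` is staticity `IsStatic`-style of `docSpacetime`),
  and `coe_flow_docKilling` — the stationary flow of the sub-space-time is `φₜ` restricted.

Everything is proved; the four definitions have bodies; no named facts are introduced (D-0026).
This is step 3 (orbit space / `⟨⟨M_ext⟩⟩ ≅ ℝ × Σ`) of the chain recorded in
`DocStaticUniquenessProofs.lean` for the static uniqueness theorem, up to (not including) the
`T`-orthogonal choice of the slice, which needs simple connectedness of `⟨⟨M_ext⟩⟩` (topological
censorship, Chruściel–Costa 2008, Cor. 2.5 — not in the tree).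

## References

* P. T. Chruściel, J. L. Costa, *On uniqueness of stationary vacuum black holes*, Astérisque 321
  (2008) 195–265, arXiv:0806.0016, Def. 1.1, §2.2, §4.2 ((4.15)), §7.2 (key `ChruscielCosta2008`).
* M. T. Anderson, *On stationary vacuum solutions to the Einstein equations*, Ann. Henri Poincaré
  1 (2000) 977–994, §0, (0.1) (key `Anderson2000`).
* P. T. Chruściel, J. L. Costa, M. Heusler, *Stationary black holes: uniqueness and beyond*,
  Living Rev. Relativity 15 (2012) 7, §3.1 (key `ChruscielCostaHeusler2012`).
* B. O'Neill, *Semi-Riemannian geometry*, Academic Press 1983, Ch. 3, p. 57 and Prop. 3.59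
  (open submanifolds, naturality of the connection and curvature), Ch. 9, Prop. 9.25 (Killing
  fields under isometries), Ch. 14, Def. 14.11 (strong causality) (key `ONeillSemiRiemannian1983`).
* S. W. Hawking, G. F. R. Ellis, *The large scale structure of space-time*, 1973, §6.6 (globally
  hyperbolic sets).
-/

noncomputable section

open Bundle Set Function Filter TopologicalSpace Manifold VectorField
open scoped Manifold ContDiff Topology

namespace Literature.Geometry.Lorentzian

universe u

/-! ### Integral curves and pulled-back fields of an open submanifold -/

section Opens

variable {E : Type*} [NormedAddCommGroup E] [NormedSpace ℝ E] {H : Type*} [TopologicalSpace H]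
  {I : ModelWithCorners ℝ E H} {M : Type*} [TopologicalSpace M] [ChartedSpace H M]

/-- **The integral curves of a vector field restricted to an open submanifold `U` are the
integral curves of the field that lie in `U`**: for `γ : ℝ → U`, the composite `ι ∘ γ` with the
inclusion is an integral curve of `V` iff `γ` is an integral curve of `V|U = V ∘ ι` (`dι = id`,
`hasMFDerivAt_subtypeVal`; `T_y U = T_y M`). Lee 2013, Prop. 3.9 and Ch. 9 (integral curves);
O'Neill 1983, Ch. 1, p. 7 and Def. 1.46 ff. [folklore] -/
theorem isMIntegralCurve_subtypeVal_comp_iff (U : Opens M) {V : Π x : M, TangentSpace I x}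
    {γ : ℝ → U} :
    IsMIntegralCurve (Subtype.val ∘ γ) V ↔
      IsMIntegralCurve (I := I) γ (fun y : U ↦ (V y.1 : TangentSpace I y)) := by
  constructor
  · intro h t
    have hd : MDifferentiableAt 𝓘(ℝ, ℝ) I γ t :=
      (mdifferentiableAt_subtypeVal_comp_curve_iff U).1 (h t).mdifferentiableAt
    have hγ' : HasMFDerivAt 𝓘(ℝ, ℝ) I γ t (mfderiv 𝓘(ℝ, ℝ) I γ t) := hd.hasMFDerivAt
    have hcomp : HasMFDerivAt 𝓘(ℝ, ℝ) I (Subtype.val ∘ γ) t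
        ((ContinuousLinearMap.id ℝ E).comp (mfderiv 𝓘(ℝ, ℝ) I γ t)) :=
      (hasMFDerivAt_subtypeVal (I' := I) (γ t)).comp t hγ'
    rw [ContinuousLinearMap.id_comp] at hcomp
    have heq : mfderiv 𝓘(ℝ, ℝ) I γ t = (1 : ℝ →L[ℝ] ℝ).smulRight (V (γ t).1) :=
      hcomp.mfderiv.symm.trans (h t).mfderiv
    rw [heq] at hγ'
    exact hγ'
  · intro h t
    exact ((hasMFDerivAt_subtypeVal (I' := I) (γ t)).comp t (h t)).congr_mfderiv
      (ContinuousLinearMap.ext fun _ ↦ rfl)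

/-- An integral curve of `V` all of whose points lie in the open set `U` is, read in `U`, an
integral curve of `V|U`. [folklore] -/
theorem isMIntegralCurve_codRestrict (U : Opens M) {V : Π x : M, TangentSpace I x}
    {γ : ℝ → M} (hγ : IsMIntegralCurve γ V) (hmem : ∀ t, γ t ∈ U) :
    IsMIntegralCurve (I := I) (fun t ↦ (⟨γ t, hmem t⟩ : U))
      (fun y : U ↦ (V y.1 : TangentSpace I y)) :=
  (isMIntegralCurve_subtypeVal_comp_iff U).1 hγ

/-- `dι(w) = w` for the inclusion `ι` of an open submanifold (`mfderiv_subtypeVal`). [folklore] -/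
theorem mfderiv_subtypeVal_apply (U : Opens M) (y : U) (w : TangentSpace I y) :
    mfderiv I I (Subtype.val : U → M) y w = w := by
  rw [mfderiv_subtypeVal]; rfl

/-- `(dι)⁻¹(w) = w` for the inclusion `ι` of an open submanifold (Mathlib's
`ContinuousLinearMap.inverse` of `dι = id`). [folklore] -/
theorem inverse_mfderiv_subtypeVal_apply (U : Opens M) (y : U) (w : TangentSpace I y.1) :
    (mfderiv I I (Subtype.val : U → M) y).inverse w = w := by
  have key : (mfderiv I I (Subtype.val : U → M) y : E →L[ℝ] E) = ContinuousLinearMap.id ℝ E :=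
    mfderiv_subtypeVal y
  change ContinuousLinearMap.inverse (mfderiv I I (Subtype.val : U → M) y : E →L[ℝ] E) w = w
  rw [key]
  exact congrArg (fun A : E →L[ℝ] E ↦ A w) (ContinuousLinearMap.inverse_id (R := ℝ) (M := E))

/-- **The pullback of a vector field along the inclusion of an open submanifold is its
restriction**: `ι^* V = V ∘ ι` (`dι = id`). O'Neill 1983, Ch. 1, p. 7. [folklore] -/
theorem mpullback_subtypeVal (U : Opens M) (V : Π x : M, TangentSpace I x) :
    mpullback I I (Subtype.val : U → M) V = fun y : U ↦ (V y.1 : TangentSpace I y) := by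
  funext y
  rw [mpullback_apply]
  exact inverse_mfderiv_subtypeVal_apply U y (V y.1)

end Opens

/-! ### Congruence of connection-dependent notions under equality of metrics -/

section Congr

variable {E : Type*} [NormedAddCommGroup E] [NormedSpace ℝ E] {H : Type*} [TopologicalSpace H]
  {I : ModelWithCorners ℝ E H} {M : Type*} [TopologicalSpace M] [ChartedSpace H M]
  [IsManifold I ∞ M] {n : ℕ∞ω}

namespace PseudoRiemannianMetric

/-- Equal metrics have equal Levi-Civita connections (whatever the proofs of the standing
Levi-Civita hypothesis); pointwise form, with the instances explicit, of
`PseudoRiemannianMetric.leviCivita_congr_metric` (`IsometricImmersionExp.lean`, not imported to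
keep geodesic theory out of the import closure). [folklore] -/
private theorem leviCivita_congr_metric'
    {g₁ g₂ : PseudoRiemannianMetric I n E (TangentSpace I : M → Type _)} (h : g₁ = g₂)
    (i₁ : g₁.HasLeviCivita) (i₂ : g₂.HasLeviCivita) (X : Π x : M, TangentSpace I x) (x : M) :
    g₁.leviCivita X x = g₂.leviCivita X x := by
  subst h; rfl

/-- Equal metrics have the same Killing fields (whatever the proofs of the standing Levi-Civita
hypothesis). [folklore] -/
theorem isKillingField_congr_metric
    {g₁ g₂ : PseudoRiemannianMetric I n E (TangentSpace I : M → Type _)} (h : g₁ = g₂)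
    (i₁ : g₁.HasLeviCivita) (i₂ : g₂.HasLeviCivita) (X : Π x : M, TangentSpace I x) :
    g₁.IsKillingField X ↔ g₂.IsKillingField X := by
  subst h; rfl

end PseudoRiemannianMetric

end Congr

/-! ### The sub-space-time `⟨⟨M_ext⟩⟩` -/

namespace StationaryAFBlackHole

variable (𝓑 : StationaryAFBlackHole.{u})
  (hF : 𝓑.metric.isOpen_chronologicalFuture 𝓑.timeOrientation)
  (hP : 𝓑.metric.isOpen_chronologicalPast 𝓑.timeOrientation)

/-- **The metric of `⟨⟨M_ext⟩⟩`**: the restriction `g|⟨⟨M_ext⟩⟩` of `g` to the open submanifold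
`𝓑.docOpens hF hP` (`LorentzianMetric.restrict`, smoothness of restricted sections by the
discharged prelude fact `contMDiff_restrict_holds`). Chruściel–Costa 2008, §2.2; O'Neill 1983,
Ch. 3, p. 57. [cite: ChruscielCosta2008, §2.2] -/
abbrev docMetric : LorentzianMetric (𝓡 4) ∞ (𝓑.docOpens hF hP) :=
  𝓑.metric.restrict PseudoRiemannianMetric.contMDiff_restrict_holds (𝓑.docOpens hF hP)

/-- **The time orientation of `⟨⟨M_ext⟩⟩`**: the restriction `τ|⟨⟨M_ext⟩⟩`
(`TimeOrientation.restrict`). Chruściel–Costa 2008, §2.2; O'Neill 1983, Ch. 5, p. 145.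
[cite: ChruscielCosta2008, §2.2] -/
abbrev docTimeOrientation : TimeOrientation (𝓑.docMetric hF hP) :=
  𝓑.timeOrientation.restrict PseudoRiemannianMetric.contMDiff_restrict_holds
    𝓑.timeOrientation.contMDiff_restrict_holds (𝓑.docOpens hF hP)

/-- The metric of `⟨⟨M_ext⟩⟩` at `y` is `g` at `↑y`. [folklore] -/
theorem docMetric_val (y : 𝓑.docOpens hF hP) : (𝓑.docMetric hF hP).val y = 𝓑.metric.val y.1 :=
  rfl

/-- The time orientation of `⟨⟨M_ext⟩⟩` at `y` is `τ` at `↑y`. [folklore] -/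
theorem docTimeOrientation_vectorField (y : 𝓑.docOpens hF hP) :
    (𝓑.docTimeOrientation hF hP).vectorField y = 𝓑.timeOrientation.vectorField y.1 :=
  rfl

/-- The standing Levi-Civita hypothesis holds for the restricted metric (every smooth metric has
its Levi-Civita connection, `PseudoRiemannianMetric.hasLeviCivita`). O'Neill 1983, Ch. 3,
Thm. 3.11. [cite: ONeillSemiRiemannian1983, Ch. 3, Thm. 3.11] -/
instance hasLeviCivita_docMetric : (𝓑.docMetric hF hP).HasLeviCivita :=
  (𝓑.docMetric hF hP).toPseudoRiemannianMetric.hasLeviCivita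

/-- **The stationary Killing field read on `⟨⟨M_ext⟩⟩`**: `T|⟨⟨M_ext⟩⟩ (y) = T(↑y)`
(`T_y ⟨⟨M_ext⟩⟩ = T_y M`). Chruściel–Costa 2008, §2.2. [cite: ChruscielCosta2008, §2.2] -/
def docKilling : Π y : 𝓑.docOpens hF hP, TangentSpace (𝓡 4) y :=
  fun y ↦ 𝓑.killing y.1

/-- Unfolding lemma for `docKilling`. [folklore] -/
@[simp]
theorem docKilling_apply (y : 𝓑.docOpens hF hP) : 𝓑.docKilling hF hP y = 𝓑.killing y.1 := rfl

/-- `T|⟨⟨M_ext⟩⟩` is the pullback `ι^* T` of `T` along the inclusion `ι : ⟨⟨M_ext⟩⟩ → M`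
(`mpullback_subtypeVal`). [folklore] -/
theorem mpullback_subtypeVal_killing :
    mpullback (𝓡 4) (𝓡 4) (Subtype.val : 𝓑.docOpens hF hP → 𝓑.carrier) 𝓑.killing =
      𝓑.docKilling hF hP :=
  mpullback_subtypeVal (𝓑.docOpens hF hP) 𝓑.killing

/-- The restricted metric is the pullback of `g` along the inclusion (`restrict_eq_comap`).
[folklore] -/
private theorem docMetric_eq_comap :
    (𝓑.docMetric hF hP).toPseudoRiemannianMetric =
      𝓑.metric.toPseudoRiemannianMetric.comap PseudoRiemannianMetric.contMDiff_pullbackBilin_holds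
        (Subtype.val : 𝓑.docOpens hF hP → 𝓑.carrier) contMDiff_subtype_val
        (injective_mfderiv_subtypeVal (𝓑.docOpens hF hP)) rfl :=
  PseudoRiemannianMetric.restrict_eq_comap 𝓑.metric.toPseudoRiemannianMetric (𝓑.docOpens hF hP)

variable {𝓑 hF hP} in
/-- **The timelike curves of `⟨⟨M_ext⟩⟩` are the timelike curves of `M` lying in it**
(`isFutureTimelikeCurveOn_restrict_iff`). [folklore] -/
theorem isFutureTimelikeCurveOn_docMetric_iff {γ : ℝ → 𝓑.docOpens hF hP} {s : Set ℝ} :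
    (𝓑.docMetric hF hP).IsFutureTimelikeCurveOn (𝓑.docTimeOrientation hF hP) γ s ↔
      𝓑.metric.IsFutureTimelikeCurveOn 𝓑.timeOrientation (Subtype.val ∘ γ) s :=
  LorentzianMetric.isFutureTimelikeCurveOn_restrict_iff 𝓑.metric 𝓑.timeOrientation _ _
    (𝓑.docOpens hF hP)

variable {𝓑} in
/-- **An `I⁺`-regular domain of outer communications is chronological.** A closed timelike curve
of the sub-space-time `⟨⟨M_ext⟩⟩` is a closed timelike curve of `M` through a point of
`⟨⟨M_ext⟩⟩` (`isFutureTimelikeCurveOn_docMetric_iff`), where strong causality holds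
(`IsIPlusRegular.isStronglyCausalAt`: `⟨⟨M_ext⟩⟩` is a globally hyperbolic set, Chruściel–Costa
2008, Def. 1.1) — and strong causality at a point excludes closed causal curves through it
(`IsStronglyCausalAt.apply_ne_of_isFutureCausalCurveOn`). Chruściel–Costa 2008, Def. 1.1;
Hawking–Ellis 1973, §6.6; O'Neill 1983, Ch. 14, Def. 14.11 and Lemma 14.10.
[cite: ChruscielCosta2008, Def. 1.1] -/
theorem IsIPlusRegular.isChronological_docSpacetime (hreg : 𝓑.IsIPlusRegular) :
    (𝓑.docMetric hF hP).IsChronological (𝓑.docTimeOrientation hF hP) := by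
  intro γ a b hab hγ hend
  have hγ' : 𝓑.metric.IsFutureTimelikeCurveOn 𝓑.timeOrientation (Subtype.val ∘ γ) (Icc a b) :=
    isFutureTimelikeCurveOn_docMetric_iff.1 hγ
  have hne := (hreg.isStronglyCausalAt (γ a).2).apply_ne_of_isFutureCausalCurveOn hab
    hγ'.isFutureCausalCurveOn rfl
  exact hne (congrArg Subtype.val hend).symm

variable [𝓑.metric.HasLeviCivita]

/-- **The domain of outer communications as a space-time**: the open sub-space-time
`(⟨⟨M_ext⟩⟩, g|⟨⟨M_ext⟩⟩, τ|⟨⟨M_ext⟩⟩)` of `𝓑` on the open submanifold `𝓑.docOpens hF hP`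
(connected by `isConnected_doc`). This is `𝓑.toSpacetime.restrict … (𝓑.docOpens hF hP) …`
(`docSpacetime_eq_restrict`), written out (and reducible) so that its carrier, metric and time
orientation are `↥(𝓑.docOpens hF hP)`, `docMetric`, `docTimeOrientation` definitionally.
Chruściel–Costa 2008, Def. 1.1 and §2.2 (the space-time `⟨⟨M_ext⟩⟩` with the induced metric and
time orientation); Hawking–Ellis 1973, §3.1. [cite: ChruscielCosta2008, Def. 1.1 and §2.2] -/
abbrev docSpacetime : Spacetime.{u} 4 where
  carrier := 𝓑.docOpens hF hP
  metric := 𝓑.docMetric hF hP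
  timeOrientation := 𝓑.docTimeOrientation hF hP
  connectedSpace := isConnected_iff_connectedSpace.mp 𝓑.isConnected_doc

/-- `docSpacetime` is the restriction of `𝓑` to `⟨⟨M_ext⟩⟩` in the sense of `Spacetime.restrict`.
[folklore] -/
theorem docSpacetime_eq_restrict :
    𝓑.docSpacetime hF hP = 𝓑.toSpacetime.restrict PseudoRiemannianMetric.contMDiff_restrict_holds
      𝓑.timeOrientation.contMDiff_restrict_holds (𝓑.docOpens hF hP) 𝓑.isConnected_doc :=
  rfl

/-- The standing Levi-Civita hypothesis for the metric of `docSpacetime` (the same instance, under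
the syntactic form met by the bundled `Spacetime` API). [folklore] -/
instance hasLeviCivita_docSpacetime : (𝓑.docSpacetime hF hP).metric.HasLeviCivita :=
  𝓑.hasLeviCivita_docMetric hF hP

/-- `T|⟨⟨M_ext⟩⟩` is a `C^∞` vector field on the open submanifold (restriction of a smooth
section, `Literature.Geometry.Manifold.OpenSubmanifold.contMDiff_tangentSection`). O'Neill 1983,
Ch. 2, pp. 36–37. [folklore] -/
theorem contMDiff_docKilling :
    ContMDiff (𝓡 4) (𝓡 4).tangent ∞ (fun y : 𝓑.docOpens hF hP ↦
      (TotalSpace.mk' E4 y (𝓑.docKilling hF hP y) : TangentBundle (𝓡 4) (𝓑.docOpens hF hP))) :=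
  Literature.Geometry.Manifold.OpenSubmanifold.contMDiff_tangentSection
    𝓑.isStationaryKilling.isKillingField.contMDiff (𝓑.docOpens hF hP)

/-- **`T|⟨⟨M_ext⟩⟩` is a Killing field of `g|⟨⟨M_ext⟩⟩`.** The restricted metric is the pullback
`ι^* g` along the inclusion (`restrict_eq_comap`), `T|⟨⟨M_ext⟩⟩ = ι^* T`
(`mpullback_subtypeVal_killing`), and Killing fields pull back to Killing fields under local
isometries (`IsKillingField.comap_mpullback`). O'Neill 1983, Ch. 9, Prop. 9.25 with Ch. 3,
p. 57 (restriction to an open set). [cite: ONeillSemiRiemannian1983, Ch. 9, Prop. 9.25] -/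
theorem isKillingField_docKilling : (𝓑.docMetric hF hP).IsKillingField (𝓑.docKilling hF hP) := by
  set gc := 𝓑.metric.toPseudoRiemannianMetric.comap
    PseudoRiemannianMetric.contMDiff_pullbackBilin_holds
    (Subtype.val : 𝓑.docOpens hF hP → 𝓑.carrier) contMDiff_subtype_val
    (injective_mfderiv_subtypeVal (𝓑.docOpens hF hP)) rfl with hgc_def
  haveI hgcLC : gc.HasLeviCivita := gc.hasLeviCivita
  have hgc : (𝓑.docMetric hF hP).toPseudoRiemannianMetric = gc := 𝓑.docMetric_eq_comap hF hP
  have key : gc.IsKillingField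
      (mpullback (𝓡 4) (𝓡 4) (Subtype.val : 𝓑.docOpens hF hP → 𝓑.carrier) 𝓑.killing) :=
    PseudoRiemannianMetric.IsKillingField.comap_mpullback 𝓑.metric.toPseudoRiemannianMetric
      PseudoRiemannianMetric.contMDiff_pullbackBilin_holds contMDiff_subtype_val
      (injective_mfderiv_subtypeVal (𝓑.docOpens hF hP)) rfl
      𝓑.isStationaryKilling.isKillingField
  rw [mpullback_subtypeVal_killing] at key
  exact (PseudoRiemannianMetric.isKillingField_congr_metric hgc inferInstance hgcLC _).2 key

/-- **The connection restricts: `∇^{g|}_v (T|) (y) = ∇^g_v T (↑y)`** (naturality of the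
Levi-Civita connection under the inclusion, `leviCivita_comap_mpullback_apply`, `dι = id`).
O'Neill 1983, Ch. 3, Prop. 3.59 and p. 57. [cite: ONeillSemiRiemannian1983, Ch. 3, Prop. 3.59] -/
theorem leviCivita_docKilling_apply (y : 𝓑.docOpens hF hP) (v : TangentSpace (𝓡 4) y) :
    (𝓑.docMetric hF hP).toPseudoRiemannianMetric.leviCivita (𝓑.docKilling hF hP) y v =
      𝓑.metric.toPseudoRiemannianMetric.leviCivita 𝓑.killing y.1 v := by
  set gc := 𝓑.metric.toPseudoRiemannianMetric.comap
    PseudoRiemannianMetric.contMDiff_pullbackBilin_holds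
    (Subtype.val : 𝓑.docOpens hF hP → 𝓑.carrier) contMDiff_subtype_val
    (injective_mfderiv_subtypeVal (𝓑.docOpens hF hP)) rfl with hgc_def
  haveI hgcLC : gc.HasLeviCivita := gc.hasLeviCivita
  have hgc : (𝓑.docMetric hF hP).toPseudoRiemannianMetric = gc := 𝓑.docMetric_eq_comap hF hP
  have hY : MDifferentiableAt (𝓡 4) (𝓡 4).tangent
      (fun x ↦ (TotalSpace.mk' E4 x (𝓑.killing x) : TangentBundle (𝓡 4) 𝓑.carrier))
      ((Subtype.val : 𝓑.docOpens hF hP → 𝓑.carrier) y) :=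
    (𝓑.isStationaryKilling.isKillingField.contMDiff y.1).mdifferentiableAt (by simp)
  rw [PseudoRiemannianMetric.leviCivita_congr_metric' hgc inferInstance hgcLC,
    ← mpullback_subtypeVal_killing,
    𝓑.metric.toPseudoRiemannianMetric.leviCivita_comap_mpullback_apply
      PseudoRiemannianMetric.contMDiff_pullbackBilin_holds contMDiff_subtype_val
      (injective_mfderiv_subtypeVal (𝓑.docOpens hF hP)) rfl hY v,
    inverse_mfderiv_subtypeVal_apply, mfderiv_subtypeVal_apply]

/-- **The twist form restricts: `ω_{T|}(y) = ω_T(↑y)`** (`g|_y = g_{↑y}`, `T|(y) = T(↑y)`,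
`∇(T|) = (∇T)|`). Chruściel–Costa–Heusler 2012, §3.1 (staticity `X♭ ∧ dX♭ = 0` is a local
condition). [cite: ChruscielCostaHeusler2012, §3.1] -/
theorem twistForm_docKilling_eq (y : 𝓑.docOpens hF hP) (u v w : TangentSpace (𝓡 4) y) :
    (𝓑.docMetric hF hP).toPseudoRiemannianMetric.twistForm (𝓑.docKilling hF hP) y u v w
      = 𝓑.metric.toPseudoRiemannianMetric.twistForm 𝓑.killing y.1 u v w := by
  simp only [PseudoRiemannianMetric.twistForm, leviCivita_docKilling_apply]
  rfl

/-- **`T` is hypersurface-orthogonal on `⟨⟨M_ext⟩⟩` iff `T|⟨⟨M_ext⟩⟩` is hypersurface-orthogonal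
on the whole sub-space-time `⟨⟨M_ext⟩⟩`**: the d.o.c.-static hypothesis
`IsHypersurfaceOrthogonalOn T 𝓑.doc` of the static uniqueness theorem
(`ChruscielGalloway2010_docStaticUniqueness`) is staticity of the space-time `docSpacetime`
(`twistForm_docKilling_eq`). Chruściel–Costa 2008, §7.2 ("`⟨⟨M_ext⟩⟩` is static");
Chruściel–Costa–Heusler 2012, §3.1. [cite: ChruscielCosta2008, §7.2] -/
theorem isHypersurfaceOrthogonalOn_docKilling_univ_iff :
    (𝓑.docMetric hF hP).toPseudoRiemannianMetric.IsHypersurfaceOrthogonalOn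
        (𝓑.docKilling hF hP) univ ↔
      𝓑.metric.toPseudoRiemannianMetric.IsHypersurfaceOrthogonalOn 𝓑.killing 𝓑.doc := by
  constructor
  · intro h x hx u v w
    have h' := h ⟨x, hx⟩ (mem_univ _) u v w
    rwa [twistForm_docKilling_eq] at h'
  · intro h y _ u v w
    rw [twistForm_docKilling_eq]
    exact h y.1 y.2 u v w

/-- **Vacuum restricts: `Ric(g|⟨⟨M_ext⟩⟩) = 0` if `Ric(g) = 0`** (locality of curvature: the
restricted metric is the pullback along the inclusion, `ricci_comap_apply`). O'Neill 1983, Ch. 3,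
Prop. 3.59. [cite: ONeillSemiRiemannian1983, Ch. 3, Prop. 3.59] -/
theorem isRicciFlat_docMetric (hvac : 𝓑.metric.toPseudoRiemannianMetric.IsRicciFlat) :
    (𝓑.docMetric hF hP).toPseudoRiemannianMetric.IsRicciFlat := by
  intro y
  set gc := 𝓑.metric.toPseudoRiemannianMetric.comap
    PseudoRiemannianMetric.contMDiff_pullbackBilin_holds
    (Subtype.val : 𝓑.docOpens hF hP → 𝓑.carrier) contMDiff_subtype_val
    (injective_mfderiv_subtypeVal (𝓑.docOpens hF hP)) rfl with hgc_def
  haveI hgcLC : gc.HasLeviCivita := gc.hasLeviCivita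
  have hgc : (𝓑.docMetric hF hP).toPseudoRiemannianMetric = gc := 𝓑.docMetric_eq_comap hF hP
  rw [PseudoRiemannianMetric.ricci_congr_metric hgc inferInstance hgcLC]
  refine LinearMap.ext fun Y₀ ↦ LinearMap.ext fun Z₀ ↦ ?_
  have key : gc.ricci y Y₀ Z₀ = 𝓑.metric.toPseudoRiemannianMetric.ricci y.1
      (mfderiv (𝓡 4) (𝓡 4) (Subtype.val : 𝓑.docOpens hF hP → 𝓑.carrier) y Y₀)
      (mfderiv (𝓡 4) (𝓡 4) (Subtype.val : 𝓑.docOpens hF hP → 𝓑.carrier) y Z₀) :=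
    PseudoRiemannianMetric.ricci_comap_apply 𝓑.metric.toPseudoRiemannianMetric
      PseudoRiemannianMetric.contMDiff_pullbackBilin_holds
      (Φ := (Subtype.val : 𝓑.docOpens hF hP → 𝓑.carrier))
      contMDiff_subtype_val (injective_mfderiv_subtypeVal (𝓑.docOpens hF hP)) rfl y Y₀ Z₀
  rw [key, hvac y.1]
  rfl

/-- **`T|⟨⟨M_ext⟩⟩` is complete**: the integral curve of `T` through a point of `⟨⟨M_ext⟩⟩` stays
in `⟨⟨M_ext⟩⟩` (`mem_doc_of_isMIntegralCurve`: the flow maps are time-orientation-preserving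
isometries leaving `M_ext`, hence `I^±(M_ext)`, invariant) and, read in the open submanifold, is a
whole-line integral curve of `T|⟨⟨M_ext⟩⟩` (`isMIntegralCurve_codRestrict`). Chruściel–Costa 2008,
§2.2 (completeness of `K`, invariance of `⟨⟨M_ext⟩⟩`). [cite: ChruscielCosta2008, §2.2] -/
theorem isCompleteVectorField_docKilling : IsCompleteVectorField (𝓑.docKilling hF hP) := by
  intro y
  obtain ⟨γ, hγ, h0⟩ := 𝓑.isStationaryKilling.isCompleteVectorField y.1
  have h0doc : γ 0 ∈ 𝓑.doc := by rw [h0]; exact y.2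
  have hmem : ∀ t, γ t ∈ 𝓑.docOpens hF hP := fun t ↦ mem_doc_of_isMIntegralCurve hγ h0doc t
  exact ⟨fun t ↦ ⟨γ t, hmem t⟩, isMIntegralCurve_codRestrict (𝓑.docOpens hF hP) hγ hmem,
    Subtype.ext h0⟩

/-- **`x ↦ g(τ, T)` is continuous** (indeed `C^∞`: both `τ` and `T` are smooth sections and `g` is
a smooth metric, `PseudoRiemannianMetric.contMDiffAt_val_apply`). [folklore] -/
theorem continuous_val_timeOrientation_killing :
    Continuous fun x ↦ 𝓑.metric.val x (𝓑.timeOrientation.vectorField x) (𝓑.killing x) := by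
  have hX := 𝓑.isStationaryKilling.isKillingField.contMDiff
  have hτ := 𝓑.timeOrientation.contMDiff
  have h : ContMDiff (𝓡 4) 𝓘(ℝ, ℝ) ∞ (fun x ↦ 𝓑.metric.toPseudoRiemannianMetric.val x
      (𝓑.timeOrientation.vectorField x) (𝓑.killing x)) := fun x ↦
    𝓑.metric.toPseudoRiemannianMetric.contMDiffAt_val_apply le_rfl (hτ x) (hX x)
  exact h.continuous

variable {𝓑} in
/-- **If `T` is timelike on `⟨⟨M_ext⟩⟩` then it is future-directed there.** The continuous
function `g(τ, T)` (`continuous_val_timeOrientation_killing`) vanishes nowhere on `⟨⟨M_ext⟩⟩`,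
where `T` is timelike (a causal vector is never orthogonal to the timelike `τ`,
`val_ne_zero_of_isTimelike_of_isCausal`), and is negative on `M_ext ⊆ ⟨⟨M_ext⟩⟩`, where `T` is
future-directed by hypothesis (`isStationaryKilling`); `⟨⟨M_ext⟩⟩` being connected
(`isConnected_doc`), it is negative throughout (intermediate value theorem on a preconnected
set). O'Neill 1983, Ch. 5, Lemma 5.26 ff. (time-cones); Chruściel–Costa 2008, §2.2.
[cite: ONeillSemiRiemannian1983, Ch. 5, Lemma 5.26 ff.] -/
theorem isFutureDirected_killing_of_forall_isTimelike
    (hT : ∀ p ∈ 𝓑.doc, 𝓑.metric.IsTimelike (𝓑.killing p)) {p : 𝓑.carrier} (hp : p ∈ 𝓑.doc) :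
    𝓑.timeOrientation.IsFutureDirected (𝓑.killing p) := by
  refine ⟨(hT p hp).isCausal, ?_⟩
  set φ : 𝓑.carrier → ℝ := fun x ↦ 𝓑.metric.val x (𝓑.timeOrientation.vectorField x)
    (𝓑.killing x) with hφ
  have hφc : Continuous φ := 𝓑.continuous_val_timeOrientation_killing
  have hφ0 : ∀ q ∈ 𝓑.doc, φ q ≠ 0 := fun q hq ↦
    𝓑.metric.val_ne_zero_of_isTimelike_of_isCausal (𝓑.timeOrientation.isTimelike q)
      (hT q hq).isCausal
  obtain ⟨m, hm⟩ := 𝓑.Mext_nonempty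
  have hmdoc : m ∈ 𝓑.doc := 𝓑.Mext_subset_doc hm
  have hmneg : φ m < 0 := (𝓑.isStationaryKilling.isTimelike hm).2.2
  by_contra hpt
  have hppos : 0 ≤ φ p := not_lt.mp hpt
  have hicc : Set.Icc (φ m) (φ p) ⊆ φ '' 𝓑.doc :=
    𝓑.isConnected_doc.isPreconnected.intermediate_value hmdoc hp hφc.continuousOn
  obtain ⟨q, hq, hq0⟩ := hicc ⟨hmneg.le, hppos⟩
  exact hφ0 q hq hq0

variable {𝓑} in
/-- **`(⟨⟨M_ext⟩⟩, g|, τ|)` with `T|⟨⟨M_ext⟩⟩` is a stationary space-time with everywhere timelike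
Killing field** (`IsStationaryKilling … univ` of `Stationary.lean`) as soon as `T` is timelike on
`⟨⟨M_ext⟩⟩`: Killing (`isKillingField_docKilling`), complete (`isCompleteVectorField_docKilling`),
timelike by hypothesis and future-directed (`isFutureDirected_killing_of_forall_isTimelike`). In the
static case the hypothesis is the conclusion of the Vishveshwara–Carter lemma with
Chruściel–Galloway 2010, Thm. 1.1 (Chruściel–Costa 2008, p. 5: "`X` is timelike on
`⟨⟨M_ext⟩⟩`"); in general it holds on `⟨⟨M_ext⟩⟩` minus the ergoregion. This is the standing
hypothesis of the orbit-space construction `StationaryOrbitSpaceManifold.lean` ff. (Anderson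
2000, §0) for the space-time `docSpacetime`. Chruściel–Costa 2008, §1.1 (p. 5), §2.2;
Chruściel–Costa–Heusler 2012, §3.1. [cite: ChruscielCosta2008, §1.1 (p. 5) and §2.2] -/
theorem isStationaryKilling_docKilling
    (hT : ∀ p ∈ 𝓑.doc, 𝓑.metric.IsTimelike (𝓑.killing p)) :
    (𝓑.docSpacetime hF hP).IsStationaryKilling (𝓑.docKilling hF hP) univ := by
  refine ⟨𝓑.isKillingField_docKilling hF hP, 𝓑.isCompleteVectorField_docKilling hF hP,
    fun y _ ↦ ⟨?_, ?_⟩⟩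
  · exact hT y.1 y.2
  · exact isFutureDirected_killing_of_forall_isTimelike hT y.2

/-! ### Consequences: time function, orbit space and trivialisation of an `I⁺`-regular d.o.c. -/

variable {𝓑} in
/-- **The stationary flow of `⟨⟨M_ext⟩⟩` is `φₜ` restricted**: for any flow `θ` of `T` on `M`
(`θ(0, ·) = id`, curves the integral curves of `T`, e.g. `exists_stationary_flow`), the chosen
flow of the stationary space-time `docSpacetime` (`IsStationaryKilling.flow`) satisfies
`↑(flow (s, y)) = θ(s, ↑y)` — uniqueness of integral curves of the smooth field `T`
(`eq_flow_of_isMIntegralCurve`), the orbit of `T|` through `y` being the orbit of `T` through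
`↑y` read in `⟨⟨M_ext⟩⟩` (`isMIntegralCurve_subtypeVal_comp_iff`). Chruściel–Costa 2008, §2.2
(`φₜ[X]`). [cite: ChruscielCosta2008, §2.2] -/
theorem coe_flow_docKilling (hT : ∀ p ∈ 𝓑.doc, 𝓑.metric.IsTimelike (𝓑.killing p))
    {θ : ℝ × 𝓑.carrier → 𝓑.carrier} (hθX : ∀ p, IsMIntegralCurve (fun t ↦ θ (t, p)) 𝓑.killing)
    (hθ0 : ∀ p, θ (0, p) = p) (s : ℝ) (y : 𝓑.docOpens hF hP) :
    ((isStationaryKilling_docKilling hF hP hT).flow (s, y) : 𝓑.docOpens hF hP).1 = θ (s, y.1) := by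
  have hK1 : ContMDiff (𝓡 4) (𝓡 4).tangent 1
      (fun x ↦ (⟨x, 𝓑.killing x⟩ : TangentBundle (𝓡 4) 𝓑.carrier)) :=
    𝓑.isStationaryKilling.isKillingField.contMDiff.of_le (WithTop.coe_le_coe.mpr le_top)
  have hγ : IsMIntegralCurve
      (Subtype.val ∘ fun t ↦ (isStationaryKilling_docKilling hF hP hT).flow (t, y)) 𝓑.killing :=
    (isMIntegralCurve_subtypeVal_comp_iff (V := 𝓑.killing) (𝓑.docOpens hF hP)).2
      ((isStationaryKilling_docKilling hF hP hT).isMIntegralCurve_flow y)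
  have h := eq_flow_of_isMIntegralCurve hK1 hθX hθ0 hγ s
  simp only [Function.comp_apply, (isStationaryKilling_docKilling hF hP hT).flow_zero] at h
  exact h

variable {𝓑} in
/-- **A global time function on an `I⁺`-regular d.o.c. with timelike Killing field** (Anderson
2000, §0, (0.1), for the space-time `⟨⟨M_ext⟩⟩`): a `C^∞` function `t : ⟨⟨M_ext⟩⟩ → ℝ` with
`t(φₛ y) = t(y) + s` along the stationary flow. Chronology of `⟨⟨M_ext⟩⟩` is
`IsIPlusRegular.isChronological_docSpacetime`. Chruściel–Costa 2008, §4.2 ((4.15): "the flow of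
`K₀` consisting of translations along the `ℝ` axis"); Anderson 2000, (0.1).
[cite: Anderson2000, §0, (0.1); ChruscielCosta2008, §4.2 (4.15)] -/
theorem IsIPlusRegular.exists_docTimeFunction (hreg : 𝓑.IsIPlusRegular)
    (hT : ∀ p ∈ 𝓑.doc, 𝓑.metric.IsTimelike (𝓑.killing p)) :
    ∃ t : 𝓑.docOpens hF hP → ℝ, ContMDiff (𝓡 4) 𝓘(ℝ, ℝ) ∞ t ∧
      ∀ (s : ℝ) (y : 𝓑.docOpens hF hP),
        t ((isStationaryKilling_docKilling hF hP hT).flow (s, y)) = t y + s :=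
  (isStationaryKilling_docKilling hF hP hT).exists_timeFunction
    (hreg.isChronological_docSpacetime hF hP)

variable {𝓑} in
/-- **The orbit space `⟨⟨M_ext⟩⟩/ℝ` of an `I⁺`-regular d.o.c. with timelike Killing field is a
smooth, Hausdorff, second countable, connected `3`-manifold** (Anderson 2000, §0, for the
space-time `⟨⟨M_ext⟩⟩`; the slice charts of `StationaryOrbitSpaceManifold.lean`). This is the
manifold `Σ` of the static form `⟨⟨M_ext⟩⟩ = ℝ × Σ`, `g = -V² dt² + γ` (Chruściel–Costa–Heusler
2012, §3.1: "the orbit space"). [cite: Anderson2000, §0; ChruscielCostaHeusler2012, §3.1] -/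
theorem IsIPlusRegular.isManifold_docOrbitSpace (hreg : 𝓑.IsIPlusRegular)
    (hT : ∀ p ∈ 𝓑.doc, 𝓑.metric.IsTimelike (𝓑.killing p)) :
    letI := (isStationaryKilling_docKilling hF hP hT).orbitSpaceChartedSpace
      (hreg.isChronological_docSpacetime hF hP)
    IsManifold (𝓡 3) ∞ (OrbitSpace (𝓑.docKilling hF hP)) ∧
      T2Space (OrbitSpace (𝓑.docKilling hF hP)) ∧
      SecondCountableTopology (OrbitSpace (𝓑.docKilling hF hP)) ∧
      ConnectedSpace (OrbitSpace (𝓑.docKilling hF hP)) :=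
  (isStationaryKilling_docKilling hF hP hT).isManifold_orbitSpace
    (hreg.isChronological_docSpacetime hF hP)

variable {𝓑} in
/-- **Trivialisation `⟨⟨M_ext⟩⟩ ≅ ℝ × (⟨⟨M_ext⟩⟩/ℝ)` of an `I⁺`-regular d.o.c. with timelike
Killing field**, the stationary flow acting by translation of the `ℝ`-factor (Anderson 2000,
(0.1), `M = ℝ × S`, `X = ∂_t`, for the space-time `⟨⟨M_ext⟩⟩`;
`Spacetime.IsStationaryKilling.exists_trivialization`). Chruściel–Costa 2008, §4.2, (4.15)
("`⟨⟨M_ext⟩⟩ ∩ M` is diffeomorphic to `ℝ × S`, with the flow of `K₀` consisting of translations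
along the `ℝ` axis" — in the strictly stationary case at hand no blow-up of an axis is involved).
[cite: ChruscielCosta2008, §4.2 (4.15); Anderson2000, §0, (0.1)] -/
theorem IsIPlusRegular.exists_docTrivialization (hreg : 𝓑.IsIPlusRegular)
    (hT : ∀ p ∈ 𝓑.doc, 𝓑.metric.IsTimelike (𝓑.killing p)) :
    letI := (isStationaryKilling_docKilling hF hP hT).orbitSpaceChartedSpace
      (hreg.isChronological_docSpacetime hF hP)
    ∃ (t : 𝓑.docOpens hF hP → ℝ)
      (Φ : Diffeomorph (𝓡 4) (𝓘(ℝ, ℝ).prod (𝓡 3)) (𝓑.docOpens hF hP)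
        (ℝ × OrbitSpace (𝓑.docKilling hF hP)) ∞),
      ContMDiff (𝓡 4) 𝓘(ℝ, ℝ) ∞ t ∧ (∀ y, Φ y = (t y, orbitProj (𝓑.docKilling hF hP) y)) ∧
        ∀ (s : ℝ) (y : 𝓑.docOpens hF hP),
          Φ ((isStationaryKilling_docKilling hF hP hT).flow (s, y)) =
            (t y + s, orbitProj (𝓑.docKilling hF hP) y) :=
  (isStationaryKilling_docKilling hF hP hT).exists_trivialization
    (hreg.isChronological_docSpacetime hF hP)

end StationaryAFBlackHole

end Literature.Geometry.Lorentzian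

end
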